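import Summits.QuantumFields.YangMills.Theorems.BalabanUVNodesN16AtKeyedHome
import Summits.QuantumFields.YangMills.Theorems.BalabanUVNodesN16OfLeaf
import HarnessLib

/-!
# Route «BalabanUVNodes», cluster K4 «SpineRates» — node N16 = NE3: THE LEAF-FORM INTERFACE SLOT `LeafSlot c` — the print-form slot `PrintSlot c` of
# `BalabanUVNodesN16RegimeDefs` with its N05-side conjunct ([Balaban1985RegularSpaces] Theorem 4 in the all-torus geometry, `Thm4TorusAt … (c.Nper·c.Lᵏ) …`)
# REPLACED BY NODE N05's OWN LEAF CONJUNCTS `B8.Thm4Body ∧ B8.Prop3Body` on n05-a's family `zdGF3 (M_N ℂ) c.L 1 len` over the univ sub-index (dag-n16-c's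
# `N16.OfLeaf.thm4TorusAt_print_of_leaf` ∘ `N16.thm4TorusAt_print_of_zd`), N07's `LeafH3sup` unchanged; `LeafSlot c → PrintSlot c`, hence
# `InEndRegime c → LeafSlot c → N16At c` in THE END's regime of record (NO second regime), and `S_N16 RRec` at any keyed rate home from the leaf-form slot

Cell `pub-ymgap`, seat `pub-ymgap-dag-n16-e` (R134 acceleration seat (a), strategy s2 = BY-NAME KNIT at the record; HUMAN RULING D-0062; chair R424 venue),
generation 2, file 7 (ONE `def` — the route-posited slot, named once as file 1 named `PrintSlot` — + theorems; 0 `sorry`).  `bears_on: R4∕N16 · edge N05 → N16 ·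
K3 SpineGivenEndpointR11 (→ its Stage-12 successor)`.  Filed `--supports stmt-QuantumFields-19676`.  Imports this seat's file 5 `BalabanUVNodesN16AtKeyedHome`
(p462618: `s_N16_of_admits`; through it file 1 p455532: `PrintSlot`, `InEndRegime`, `n16At_of_inEndRegime_printSlot`) and dag-n16-c's file 5 `BalabanUVNodesN16OfLeaf`
(p464578: `thm4TorusAt_print_of_leaf`; through it `…N16Thm4TorusOfZd` p453640: `thm4TorusAt_print_of_zd`).  Restates nothing; cites by name.

WHY (dag-n16-c LANDED-5, pub-ymgap INBOX 2026-08-26T19:33Z: «the in-edge N05 → N16 now reads, kernel-checked end to end, N05's leaf conjuncts t4 ∧ p3 on `zdGF3 (M_n ℂ)`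
RESTRICTED to {i.Ω 0 = univ} ⟹ (with N07's H3sup and THE END's letters) `NE3EnergyRateWCov …`; cc n16-e (s2: `n16_of_leaf` is the ℤᵈ-leaf twin of your record knit's
T4 input)»).  The homes of record (this seat's files 4–6, `RRec₁₁` ∕ `RRec₁₂` ∕ any keyed home) consume N16 through the proviso `InEndRegime` and the slot `PrintSlot`,
whose N05-side conjunct is the INTERMEDIATE interface `Thm4TorusAt c.L k (c.Nper·c.Lᵏ) (c.Lᵏ)⁻¹ c₁ unitaryUnits (Reg335Zd …) (Restr129 …) Concl_print(B, B_h)`.  n16-c's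
chain supplies exactly that conjunct from N05's TYPED LEAF: `thm4TorusAt_print_of_leaf` (leaf t4 ∧ p3 + the eleven-line window at `c₁′` ⟹ the period-`0` interface
with Concl⁰_print, `B = 5·4·L·B₀`, `B_h = 5·4·L·B₀(β₀)`, `β₀ = 1`) and `thm4TorusAt_print_of_zd` (period `0` ⟹ period `Nper·Lᵏ` under `0 ≤ B`, `16·B·c₁′ ≤ 1`).  THIS FILE
names the slot with that substitution made — `LeafSlot c` — and proves `LeafSlot c → PrintSlot c`; so the pin of a reading at ANY home owes, on the N05 side,
LITERALLY N05's leaf statements `B8.Thm4Body c₁ B₁′ (fun i : {i : ZdIdx 4 c.L // i.Ω 0 = univ} ↦ (zdGF3 (M_N ℂ) c.L 1 len i.1).toGFData)` and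
`B8.Prop3Body cP 4 c.L C₂ inp B₀β (… .toGFData2)` (n05-a's `thm4Printed_zd3` ∕ `prop3Printed_zd3` on the univ sub-family, modulo THEIR sockets), plus N07's `LeafH3sup`
and the displayed letters — THE END's thresholds `radiusOfRecord` ∕ `constOfRecord` UNCHANGED (no second regime is introduced).

CONTENT.
§1 `LeafSlot c` (def) — `PrintSlot c` with `c₁ := c₁′`, `B := 5·4·c.L·inp.B₀`, `B_h := 5·4·c.L·B₀β` and the `Thm4TorusAt` conjunct replaced by: a length function
   `len` (`≥ 1` on its support, `len e_μ = 1`), N05's Theorem-4 constant `c₁` and Prop-3 letters `(B₁′, cP, C₂, B₀β, inp)` with `0 < B₁′`, `5·4·c.L·B₀ ≤ B₁′`,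
   `16·(B·c₁′) ≤ 1`, the eleven-line window of `N16.OfLeaf` at `c₁′`, and the two LEAF CLAUSES; `leafSlot_iff` (`Iff.rfl`).
§2 `printSlot_of_leafSlot` (`2 ≤ c.L`): the substitution is sound — n16-c's two theorems, the Concl literal matched by `rw` on the letter identities.
§3 `n16At_of_inEndRegime_leafSlot` (THE ONE-APPLICATION CLOSER in the leaf currency: `InEndRegime c → LeafSlot c → N16At c`, `2 ≤ c.L` from the proviso) and
   `s_N16_of_admits_inEndRegime_leafSlot` (THE KNIT AT ANY KEYED HOME in the leaf currency, file 5's `s_N16_of_admits`).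

HONEST FRAMING.  One definition (a hypothesis SHAPE, asserted for no bundle) + kernel bookkeeping by name over dag-n16-c's landed theorems; no estimate of mine.  The
leaf clauses are NODE N05's theorems ([Balaban1985RegularSpaces] Thm 4 + Prop 3 at curved backgrounds on the `ℤᵈ` carriers — NOT proved in the tree: N05's sockets
SockP5base ∕ SockP5 ∕ SockH59 ∕ SockP5u ∕ SockB9P3); `LeafH3sup` is N07's [Balaban1985Variational] Thm 1 (8)+(10) TYPE (NOT proved); `InEndRegime` is displayed by a
pin, discharged by nobody for a reading of record; **N16 ∕ NE3 is NOT discharged**; count-neutral; one finite four-torus at fixed ε — NOT ℝ⁴, NOT infinite volume, NOT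
OS, NOT a mass gap, NOT Clay.
-/

set_option autoImplicit false

open scoped BigOperators Matrix Matrix.Norms.L2Operator
open NormedSpace

namespace Summit.QuantumFields.YangMills.BalabanUVNodes.N16LeafSlot

open Literature.MathematicalPhysics.QuantumFieldTheory.Balaban1983to89
open Literature.MathematicalPhysics.QuantumFieldTheory.Balaban1983to89.T4Continuum (T4Family ULoop)
open B7Prop1Explicit B7Prop2Explicit
open B7Prop3Flat (c3)
open B7Eq92Concrete (mgauge)
open B8Ineq132 (covDerivFwd)
open B8Eq184Proof (cfgExp)
open B8Eq119TwistedAxial (Restr129)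
open B8Eq133Hypotheses (Reg335Zd)
open B8Eq138LandauZd (IsLandau138 covLap)
open B8Thm4TorusAt (torusLam Thm4TorusAt)
open B8LeafModelZd (ZdIdx)
open B8LeafModelZd3 (zdGF3)
open Summit.QuantumFields.BalabanUV.T4Continuum
open T4AveragingDeficitWall (Ad)
open BlockAverageCurrent (curConst)
open NE3RightInverseSupLetters (frameC)
open NE3.LeafIndexSockets (LeafH3sup)
open Node00 (NE3Objects₁₁)
open YMDAG.UVSplit (Datum NE3Carriers RateCarriers RateRecordPred N16At S_N16 ne3OfRecord₁₁)
open Summit.QuantumFields.YangMills.BalabanUVNodes.N16Regime (PrintSlot InEndRegime n16At_of_inEndRegime_printSlot)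
open Summit.QuantumFields.YangMills.BalabanUVNodes.N16AtKeyedHome (s_N16_of_admits)
open Summit.QuantumFields.YangMills.BalabanUVNodes.N16.OfLeaf (thm4TorusAt_print_of_leaf)
open Summit.QuantumFields.YangMills.BalabanUVNodes.N16 (thm4TorusAt_print_of_zd)

noncomputable section

/-! ## §1 The leaf-form interface slot at a bundle, NAMED -/

/-- **THE LEAF-FORM INTERFACE SLOT AT A BUNDLE `c : NE3Carriers N`** — `PrintSlot c` with its Theorem-4-in-the-all-torus-geometry conjunct REPLACED by node N05's own
leaf conjuncts: for SOME length function `len` (`≥ 1` on its support, `len e_μ = 1`), Theorem-4 constant `c₁`, window `c₁′`, Prop-3 letters `(B₁′, cP, C₂, B₀β, inp)`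
with `0 < B₁′`, `5·4·c.L·B₀ ≤ B₁′`, output constants `B = 5·4·c.L·B₀`, `B_h = 5·4·c.L·B₀β` with `16·(B·c₁′) ≤ 1`, the eleven-line window at `c₁′`, leaf letters `(b′, c′)`
on the two ε-free lines, an averaging letter `α` in the displayed window with `c.ε < α`, a (3.35) schedule `(Mc, 𝒬, C₃₃₅)` and the four k-free letter lines:
`B8.Thm4Body c₁ B₁′` AND `B8.Prop3Body cP 4 c.L C₂ inp B₀β` on `fun i : {i : ZdIdx 4 c.L // i.Ω 0 = univ} ↦ zdGF3 (M_N ℂ) c.L 1 len i.1` ([Balaban1985RegularSpaces]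
Thm 4 ∕ Prop 3 as typed by n05-a, restricted to the all-torus sub-family), AND N07's `LeafH3sup 4 c.L c.Nper c.ε b′ c′ c.dom`.  A hypothesis SHAPE — asserted for
no bundle here. [folklore] -/
@[folklore]
def LeafSlot {N : ℕ} (c : NE3Carriers N) : Prop :=
  letI : CStarAlgebra (Matrix (Fin N) (Fin N) ℂ) := {}
  ∃ (len : Site 4 → ℝ) (c₁ c₁' B₁' cP C₂ B₀β : ℝ) (inp : B8.B9Inputs) (B Bh b' c' α Mc C335 : ℝ) (𝒬 : ℕ → Set (Set (Site 4) × ℕ)),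
    (∀ v : Site 4, 0 < len v → 1 ≤ len v) ∧ (∀ μ : Fin 4, len (e μ) = 1) ∧ 0 < B₁' ∧ 5 * ((4 : ℕ) : ℝ) * c.L * inp.B₀ ≤ B₁' ∧
    B = 5 * ((4 : ℕ) : ℝ) * c.L * inp.B₀ ∧ Bh = 5 * ((4 : ℕ) : ℝ) * c.L * B₀β ∧ 16 * (B * c₁') ≤ 1 ∧
    (∀ α₀ α₁ : ℝ, 0 < α₀ → 0 < α₁ → α₀ + α₁ ≤ c₁' →
      α₀ + α₁ ≤ c₁ ∧ C0 4 * (2 * α₀) ≤ 1 / 3 ∧ 4 * α₀ ≤ c2' 4 c.L ∧ 16 * (B₁' * (α₀ + α₁)) ≤ 1 ∧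
      Real.exp (4 * (800 * (((4 : ℕ) : ℝ) + 1) ^ 2 * (((4 : ℕ) : ℝ) + 4)) * α₀) * (1 + 8 * (131072 * (((4 : ℕ) : ℝ) + 1) ^ 2) * (B₁' * (α₀ + α₁))) ≤ 2 ∧
      2 * (B₁' * (α₀ + α₁)) ≤ c3 4 c.L ∧ ((4 : ℕ) : ℝ) * c.L * α₁ ≤ 1 / 8 ∧ α₀ ≤ cP ∧ α₁ ≤ cP ∧ B₁' * (α₀ + α₁) ≤ cP ∧
      2 * (B₁' * (α₀ + α₁)) ^ 2 + 20 * ((4 : ℕ) : ℝ) * α₀ * (B₁' * (α₀ + α₁)) + 2 * C₂ * (B₁' * (α₀ + α₁)) ^ 2 ≤ α₀ + α₁) ∧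
    0 ≤ b' ∧ 0 ≤ c' ∧ 2 ^ 15 * ((4 : ℝ) + 1) ^ 2 * ((4 : ℝ) + 4) ^ 2 * (c.L : ℝ) ^ 2 * b' ≤ 1 ∧
    23040 * (4 : ℝ) ^ 4 * (frameC 4 c.L + 4) ^ 3 * (c' + curConst 4 c.L * b' ^ 2) ≤ 1 ∧
    0 < α ∧ C0 4 * α ≤ 1 / 3 ∧ 2 * α ≤ c2' 4 c.L ∧ 11 * (4 : ℝ) ^ 2 * α ≤ 1 / 6 ∧ α + 11 * (4 : ℝ) ^ 2 * α ≤ c₁' ∧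
    (b' + 226 * (8 * ((4 : ℝ) + 1) * ((4 : ℝ) + 4)) ^ 2 * b' ^ 2) < α ∧ 4 * ((4 : ℝ) - 1) * (c' + curConst 4 c.L * b' ^ 2) < α ∧
    0 ≤ Mc ∧ (Mc + 1) * (b' + 226 * (8 * ((4 : ℝ) + 1) * ((4 : ℝ) + 4)) ^ 2 * b' ^ 2) ≤ 1 / 2 ∧
    (∀ k, ∀ q ∈ 𝒬 k, q.2 ≤ k ∧ ∃ y : Site 4, ∀ z ∈ q.1, (l1 (z - y) : ℝ) ≤ Mc * (c.L : ℝ) ^ q.2) ∧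
    2 * (Mc + 1) * (b' + 226 * (8 * ((4 : ℝ) + 1) * ((4 : ℝ) + 4)) ^ 2 * b' ^ 2) + 2 * Mc * (2 * (c' + curConst 4 c.L * b' ^ 2)) +
      4 * Mc * (1 + 2 * Mc) * (b' + 226 * (8 * ((4 : ℝ) + 1) * ((4 : ℝ) + 4)) ^ 2 * b' ^ 2) ^ 2 < C335 ∧
    c.ε < α ∧ B * (α + 11 * (4 : ℝ) ^ 2 * α) ≤ c.Λ₁ ∧
    B * (α + 11 * (4 : ℝ) ^ 2 * α) + 2 * (b' + 226 * (8 * ((4 : ℝ) + 1) * ((4 : ℝ) + 4)) ^ 2 * b' ^ 2) * c.Λ₁ ≤ c.Λ₁ ∧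
    B * (α + 11 * (4 : ℝ) ^ 2 * α) + 16 * (b' + 226 * (8 * ((4 : ℝ) + 1) * ((4 : ℝ) + 4)) ^ 2 * b' ^ 2) * (B * (α + 11 * (4 : ℝ) ^ 2 * α)) ≤ c.Λ₁ ∧
    Bh * (α + 11 * (4 : ℝ) ^ 2 * α) + 8 * (b' + 226 * (8 * ((4 : ℝ) + 1) * ((4 : ℝ) + 4)) ^ 2 * b' ^ 2) * (B * (α + 11 * (4 : ℝ) ^ 2 * α)) ≤ c.Λ₂' ∧
    B8.Thm4Body c₁ B₁' (fun i : {i : ZdIdx 4 c.L // i.Ω 0 = Set.univ} => (zdGF3 (Matrix (Fin N) (Fin N) ℂ) c.L 1 len i.1).toGFData) ∧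
    B8.Prop3Body cP 4 (c.L : ℝ) C₂ inp B₀β (fun i : {i : ZdIdx 4 c.L // i.Ω 0 = Set.univ} => (zdGF3 (Matrix (Fin N) (Fin N) ℂ) c.L 1 len i.1).toGFData2) ∧
    LeafH3sup 4 c.L c.Nper c.ε b' c' c.dom

/-! ## §2 The leaf-form slot implies the print-form slot -/

/-- **`LeafSlot c → PrintSlot c`** (`2 ≤ c.L`): N05's leaf conjuncts on the univ sub-family + the window give Theorem 4 on the `ℤᵈ` carriers at every level
`k ≥ 1` in N16's letters without periodicity (dag-n16-c `N16.OfLeaf.thm4TorusAt_print_of_leaf`, `B = 5·4·L·B₀`, `B_h = 5·4·L·B₀β`, `β₀ = 1`), and the periodicity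
principle upgrades it to the all-torus geometry at period `c.Nper·c.Lᵏ` (`N16.thm4TorusAt_print_of_zd`, under `0 ≤ B`, `16·B·c₁′ ≤ 1`); the other
conjuncts of `PrintSlot c` are carried verbatim with `c₁ := c₁′`. [folklore] -/
theorem printSlot_of_leafSlot {N : ℕ} [NeZero N] (c : NE3Carriers N) (hL : 2 ≤ c.L) (h : LeafSlot c) : PrintSlot c := by
  letI : CStarAlgebra (Matrix (Fin N) (Fin N) ℂ) := {}
  haveI : Nonempty (Fin N) := ⟨⟨0, Nat.pos_of_ne_zero (NeZero.ne N)⟩⟩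
  obtain ⟨len, c₁, c₁', B₁', cP, C₂, B₀β, inp, B, Bh, b', c', α, Mc, C335, 𝒬, hlen, hlen1, hB₁', hBB, hBdef, hBhdef, hBc, hwin,
    hb', hc', hRb, hcF, hα, hA3, hA2, hAs, hAc, hb'α, hc'α, hMc, hMcα, h𝒬, hC335, hεα, hss, hgrad, hℓ, hhol, hT, hP, h3⟩ := h
  have hL1 : 1 ≤ c.L := le_trans one_le_two hL
  have hB0 : 0 ≤ B := by rw [hBdef]; have := inp.B₀_pos.le; positivity
  -- N05's leaf ⟹ Theorem 4 on the `ℤᵈ` carriers at every level (period `0`), in N16's letters with `B`, `B_h`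
  have hzd := thm4TorusAt_print_of_leaf (d := 4) (n := Fin N) (by norm_num) hL zero_le_one hlen hlen1 hB₁' hBB hwin
    (fun k => Reg335Zd (((c.L : ℝ) ^ k)⁻¹) c.L (𝒬 k) C335) hT hP
  refine ⟨c₁', B, Bh, b', c', α, Mc, C335, 𝒬, hb', hc', hRb, hcF, hα, hA3, hA2, hAs, hAc, hb'α, hc'α, hMc, hMcα, h𝒬, hC335, hεα, hss, hgrad, hℓ,
    hhol, fun k hk => ?_, h3⟩
  have hη : 0 < ((c.L : ℝ) ^ k)⁻¹ := by
    have : (0 : ℝ) < c.L := by exact_mod_cast lt_of_lt_of_le one_pos hL1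
    positivity
  have hη1 : ((c.L : ℝ) ^ k)⁻¹ ≤ 1 := inv_le_one_of_one_le₀ (one_le_pow₀ (by exact_mod_cast hL1))
  have hk' := hzd k hk
  rw [← hBdef, ← hBhdef] at hk'
  exact thm4TorusAt_print_of_zd (d := 4) (n := Fin N) hL1 k c.Nper hη hη1 hB0 hBc _ hk'

/-! ## §3 The one-application closer and the knit at any keyed home, in the leaf currency -/

/-- **THE ONE-APPLICATION CLOSER IN THE LEAF CURRENCY — `InEndRegime c → LeafSlot c → N16At c`**: a bundle in THE END's regime of record (file 1's thresholds,
unchanged) carrying the leaf-form slot satisfies N16's record decl (`printSlot_of_leafSlot` + file 1's `n16At_of_inEndRegime_printSlot`; `2 ≤ c.L` is the proviso's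
first clause). [folklore] -/
theorem n16At_of_inEndRegime_leafSlot {N : ℕ} [NeZero N] {c : NE3Carriers N} (hreg : InEndRegime c) (hslot : LeafSlot c) : N16At c :=
  n16At_of_inEndRegime_printSlot hreg (printSlot_of_leafSlot c hreg.1 hslot)

/-- **THE KNIT AT ANY KEYED HOME IN THE LEAF CURRENCY** — `S_N16 RRec` for every home admitting only the literals of a key-indexed NE3 reading (`hadm`, file 5) at
which the proviso `InEndRegime` and the leaf-form slot `LeafSlot` hold: the N05 in-edge of «N16 at the record» consumed in N05's OWN typed currency (its leaf
`B8.Thm4Body ∧ B8.Prop3Body` on the univ sub-family of `zdGF3`), N07's as `LeafH3sup`.  Neither is asserted here. [folklore] -/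
theorem s_N16_of_admits_inEndRegime_leafSlot {N : ℕ} [NeZero N] {key : (F : T4Family) → Datum F N → Prop}
    (ne3At : ∀ {F : T4Family} {D : Datum F N}, key F D → (ℕ → ℝ) → List (ULoop F) → ℕ → NE3Objects₁₁ N) (RRec : RateRecordPred N)
    (hadm : ∀ (F : T4Family) (D : Datum F N) (g₀ : ℕ → ℝ) (os : List (ULoop F)) (R : RateCarriers N), RRec F D g₀ os R →
      ∃ (h : key F D) (k : ℕ), R.ne3 = ne3OfRecord₁₁ F (ne3At h g₀ os k))
    (h : ∀ (F : T4Family) (D : Datum F N) (h : key F D) (g₀ : ℕ → ℝ) (os : List (ULoop F)) (k : ℕ),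
      InEndRegime (ne3OfRecord₁₁ F (ne3At h g₀ os k)) ∧ LeafSlot (ne3OfRecord₁₁ F (ne3At h g₀ os k))) :
    S_N16 RRec :=
  s_N16_of_admits ne3At RRec hadm fun F D hk g₀ os k => n16At_of_inEndRegime_leafSlot (h F D hk g₀ os k).1 (h F D hk g₀ os k).2

end

end Summit.QuantumFields.YangMills.BalabanUVNodes.N16LeafSlot
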